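import Summits.SmoothPoincare4.SmoothPoincare4.Theorems.CylinderEntropyCylinderRungTwoFluxIdentityMultiplicity
import Literature.Geometry.Riemannian.EmbeddedSubmanifoldHausdorff
import HarnessLib

/-!
# Route `CylinderEntropy`, item `ImmortalAreaToFloor` (stmt-SmoothPoincare4-17197):
# counting — a set of the cross-section with injective shadow and vertical angle bounded below has
# area at most `vol(S⁴)/s₀` (module Γ7 of `BLUEPRINT-17197-c2.md`)

For a smooth embedded cross-section `ι : M⁴ → N = S⁴ × ℝ ⊂ ℝ⁶` with continuous unit normal `ν`
tangent to `N` and a measurable `P ⊆ M` on which the shadow `σ = truncL ∘ ι : M → S⁴` is INJECTIVE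
and `|ν₅| ≥ s₀ > 0`:
* `ofReal_mul_comap_le_of_injOn_shadow` — `s₀ · (ι^*𝓗⁴)(P) ≤ 𝓗⁴(S⁴)` (Mathlib's Euclidean
  Hausdorff measures): the landed multiplicity area formula for the shadow
  (`lintegral_abs_nu5_eq_lintegral_encard`, Federer 3.2.3: `∫_P |ν₅| d(ι^*𝓗⁴) = ∫ #(σ⁻¹{p} ∩ P) d𝓗⁴(p)`)
  with multiplicity `≤ 1` on `S⁴` and `0` off `S⁴`;
* `ofReal_mul_riemannianMeasure_le_of_injOn_shadow` — the same with the induced area measure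
  `μ_{ι^*δ}(P)` (`= (ι^*𝓗⁴)(P)` by the tree's area formula `riemannianMeasure_induced_apply`).
In the proof of `ImmortalAreaToFloor`, `P` is the GOOD SET of a late good-time slice (no two good
points on one vertical, `|ν₅| ≥ √(1-ξ)` at good points), so `μ(good) ≤ vol(S⁴)/√(1-ξ)`.

References: H. Federer, *Geometric Measure Theory* (1969), 3.2.3; W. K. Allard, Ann. of Math. 95
(1972) §6.
-/

-- the prescribed namespace `Summit.SmoothPoincare4.SmoothPoincare4.…` repeats `SmoothPoincare4`
set_option linter.dupNamespace false

noncomputable section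

open MeasureTheory Set Function Filter Module
open scoped Manifold ContDiff ENNReal Topology RealInnerProductSpace NNReal

namespace Summit.SmoothPoincare4.SmoothPoincare4.Cruxes.CylinderRungTwo.KillingFlux

open Literature.Geometry.Riemannian
open Literature.Geometry.Lorentzian Literature.Geometry.Lorentzian.PseudoRiemannianMetric
open Literature.Geometry.Riemannian.SphericalCylinderEntropy (truncL truncL_apply)
open Summit.SmoothPoincare4.SmoothPoincare4.Theorems.CylinderRungTwo.KillingFlux
  (lintegral_abs_nu5_eq_lintegral_encard)

variable {M : Type} [TopologicalSpace M] [ChartedSpace (EuclideanSpace ℝ (Fin 4)) M] [IsManifold (𝓡 4) ∞ M]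
  [CompactSpace M] [MeasurableSpace M] [BorelSpace M] [SecondCountableTopology M] [Nonempty M]

/-- **Counting with the multiplicity area formula.**  For a smooth embedded cross-section
`ι : M → N` with continuous unit normal `ν` tangent to `N`, a measurable `P ⊆ M`, `s₀ > 0` with
`|ν₅| ≥ s₀` on `P`, and the shadow `truncL ∘ ι` injective on `P`:
`ofReal s₀ · (Measure.comap ι μHE⁴)(P) ≤ μHE⁴(S⁴ ⊂ ℝ⁵)`. [cite: Federer1969, 3.2.3] -/
theorem ofReal_mul_comap_le_of_injOn_shadow {ι ν : M → EuclideanSpace ℝ (Fin 6)}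
    (hι : Manifold.IsSmoothEmbedding (𝓡 4) (𝓡 6) ∞ ι)
    (hιN : ∀ x, ∑ i : Fin 5, ι x (Fin.castSucc i) ^ 2 = 1)
    (hνc : Continuous ν) (hνn : (euclideanMetric (EuclideanSpace ℝ (Fin 6))).IsUnitNormal (𝓡 4) ι ν 1)
    (hνt : ∀ x, ∑ i : Fin 5, ν x (Fin.castSucc i) * ι x (Fin.castSucc i) = 0)
    {P : Set M} (hPm : MeasurableSet P) {s₀ : ℝ} (hs₀ : 0 < s₀) (hP : ∀ x ∈ P, s₀ ≤ |ν x 5|)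
    (hinj : InjOn (fun x => truncL (ι x)) P) :
    ENNReal.ofReal s₀ * (Measure.comap ι (μHE[4] : Measure (EuclideanSpace ℝ (Fin 6)))) P ≤
      (μHE[4] : Measure (EuclideanSpace ℝ (Fin 5))) (Metric.sphere (0 : EuclideanSpace ℝ (Fin 5)) 1) := by
  classical
  set σ : M → EuclideanSpace ℝ (Fin 5) := fun x => truncL (ι x) with hσ
  have hP0 : P ⊆ {x | ν x 5 ≠ 0} := by
    intro x hx h0
    have h := hP x hx
    have h0' : ν x 5 = 0 := h0
    rw [h0', abs_zero] at h
    exact absurd h (not_le.2 hs₀)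
  obtain ⟨-, hformula⟩ := lintegral_abs_nu5_eq_lintegral_encard hι hιN hνc hνn hνt hPm hP0
  -- the shadow lands in the unit sphere
  have hσS : ∀ x, σ x ∈ Metric.sphere (0 : EuclideanSpace ℝ (Fin 5)) 1 := fun x => by
    rw [mem_sphere_zero_iff_norm, EuclideanSpace.norm_eq, Real.sqrt_eq_one]
    simpa [hσ, truncL_apply, Real.norm_eq_abs, sq_abs] using hιN x
  have hSm : MeasurableSet (Metric.sphere (0 : EuclideanSpace ℝ (Fin 5)) 1) :=
    Metric.isClosed_sphere.measurableSet
  -- multiplicity `≤ 1_{S⁴}`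
  have hmult : ∀ p : EuclideanSpace ℝ (Fin 5),
      (((fun x => truncL (ι x)) ⁻¹' {p} ∩ P).encard : ℝ≥0∞) ≤
        (Metric.sphere (0 : EuclideanSpace ℝ (Fin 5)) 1).indicator 1 p := by
    intro p
    by_cases hp : p ∈ Metric.sphere (0 : EuclideanSpace ℝ (Fin 5)) 1
    · rw [indicator_of_mem hp, Pi.one_apply]
      have h1 : ((fun x => truncL (ι x)) ⁻¹' {p} ∩ P).encard ≤ 1 := by
        rw [Set.encard_le_one_iff]
        rintro a b ⟨ha, haP⟩ ⟨hb, hbP⟩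
        rw [mem_preimage, mem_singleton_iff] at ha hb
        exact hinj haP hbP (ha.trans hb.symm)
      have h2 := ENat.toENNReal_le.2 h1
      simpa using h2
    · rw [indicator_of_notMem hp]
      have : (fun x => truncL (ι x)) ⁻¹' {p} ∩ P = ∅ := by
        ext x
        simp only [mem_inter_iff, mem_preimage, mem_singleton_iff, mem_empty_iff_false, iff_false,
          not_and]
        intro hx
        exact absurd (hx ▸ hσS x) hp
      rw [this, Set.encard_empty, ENat.toENNReal_zero]
  -- assemble
  calc ENNReal.ofReal s₀ * (Measure.comap ι (μHE[4] : Measure (EuclideanSpace ℝ (Fin 6)))) P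
      = ∫⁻ _ in P, ENNReal.ofReal s₀ ∂(Measure.comap ι (μHE[4] : Measure (EuclideanSpace ℝ (Fin 6)))) :=
        (setLIntegral_const P _).symm
    _ ≤ ∫⁻ x in P, ENNReal.ofReal |ν x 5| ∂(Measure.comap ι (μHE[4] : Measure (EuclideanSpace ℝ (Fin 6)))) :=
        setLIntegral_mono' hPm fun x hx => ENNReal.ofReal_le_ofReal (hP x hx)
    _ = ∫⁻ p, (((fun x => truncL (ι x)) ⁻¹' {p} ∩ P).encard : ℝ≥0∞)
          ∂(μHE[4] : Measure (EuclideanSpace ℝ (Fin 5))) := hformula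
    _ ≤ ∫⁻ p, (Metric.sphere (0 : EuclideanSpace ℝ (Fin 5)) 1).indicator 1 p
          ∂(μHE[4] : Measure (EuclideanSpace ℝ (Fin 5))) := lintegral_mono hmult
    _ = (μHE[4] : Measure (EuclideanSpace ℝ (Fin 5))) (Metric.sphere (0 : EuclideanSpace ℝ (Fin 5)) 1) :=
        lintegral_indicator_one hSm

/-- **Counting, in terms of the induced area measure.**  Under the hypotheses of
`ofReal_mul_comap_le_of_injOn_shadow`, with `ι` also a spacelike immersion (so that the induced
area measure `μ_{ι^*δ}` is available): `ofReal s₀ · μ_{ι^*δ}(P) ≤ μHE⁴(S⁴ ⊂ ℝ⁵)`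
(`μ_{ι^*δ}(P) = μHE⁴(ι(P)) = (ι^*μHE⁴)(P)`, tree `riemannianMeasure_induced_apply`).
[cite: Federer1969, 3.2.3] -/
theorem ofReal_mul_riemannianMeasure_le_of_injOn_shadow [T2Space M] {ι ν : M → EuclideanSpace ℝ (Fin 6)}
    (hι : Manifold.IsSmoothEmbedding (𝓡 4) (𝓡 6) ∞ ι)
    (himm : (euclideanMetric (EuclideanSpace ℝ (Fin 6))).IsSpacelikeImmersion (𝓡 4) ι)
    (hιN : ∀ x, ∑ i : Fin 5, ι x (Fin.castSucc i) ^ 2 = 1)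
    (hνc : Continuous ν) (hνn : (euclideanMetric (EuclideanSpace ℝ (Fin 6))).IsUnitNormal (𝓡 4) ι ν 1)
    (hνt : ∀ x, ∑ i : Fin 5, ν x (Fin.castSucc i) * ι x (Fin.castSucc i) = 0)
    {P : Set M} (hPm : MeasurableSet P) {s₀ : ℝ} (hs₀ : 0 < s₀) (hP : ∀ x ∈ P, s₀ ≤ |ν x 5|)
    (hinj : InjOn (fun x => truncL (ι x)) P) :
    ENNReal.ofReal s₀ *
        riemannianMeasure ((euclideanMetric (EuclideanSpace ℝ (Fin 6))).inducedRiemannianMetric ι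
          contMDiff_pullbackBilin_holds himm) P ≤
      (μHE[4] : Measure (EuclideanSpace ℝ (Fin 5))) (Metric.sphere (0 : EuclideanSpace ℝ (Fin 5)) 1) := by
  have hinjι : Injective ι := hι.isEmbedding.injective
  have hme : MeasurableEmbedding ι :=
    (himm.contMDiff.continuous.isClosedEmbedding hinjι).measurableEmbedding
  have heq : riemannianMeasure ((euclideanMetric (EuclideanSpace ℝ (Fin 6))).inducedRiemannianMetric ι
      contMDiff_pullbackBilin_holds himm) P =
      (Measure.comap ι (μHE[4] : Measure (EuclideanSpace ℝ (Fin 6)))) P := by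
    rw [riemannianMeasure_induced_apply himm hinjι hPm, hme.comap_apply]
  rw [heq]
  exact ofReal_mul_comap_le_of_injOn_shadow hι hιN hνc hνn hνt hPm hs₀ hP hinj

end Summit.SmoothPoincare4.SmoothPoincare4.Cruxes.CylinderRungTwo.KillingFlux

end
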